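import Mathlib
import HarnessLib

/-!
# MÜLLER'S COMPARISON THEOREM WITH DISTURBANCE (strict form, within-`[0,T]` derivatives, general `Fin n` system)
# — the `stub_comparison` of line `coopembed_v1` on crux `RelayFrontStep` (stmt-NavierStokesRegularity-24850)

Seat ns-es-p1 g3 (director-ns KEY-NS #81 (3) «bankable spare»; line owner ns-idea-4 g7, LEAD ns-crc-p1, critic idea-crit-3;
MODEL lattice — route CompletionRelayChain → rung TL-M3-R64).  `--supports stmt-NavierStokesRegularity-24850 --as helper`.

The line file `pub/ideators/ns-idea-4/RelayFrontStep_coopembed_v1.lean` (v1.2) is not in the tree, so this file states the CONTENT of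
its `def MullerComparison : Prop` verbatim as the theorem `mullerComparison`; the line's `stub_comparison : MullerComparison` then
closes by `exact …Theorems.CompletionRelayChainRelayFrontStepMullerComparison.mullerComparison`.

STATEMENT.  For a system `żᵢ = fᵢ(z) + dᵢ(t)` with `|dᵢ| ≤ δ` on `[0,T]` (derivatives WITHIN `Icc 0 T`) and a `C¹` box-valued pair
`(lo, hi)` satisfying the strict EMBEDDING (face) inequalities — `lo′ᵢ(t) + δ < fᵢ(w)` for every `w` in the closed box `[lo(t), hi(t)]`
with `wᵢ = loᵢ(t)`, and `fᵢ(w) + δ < hi′ᵢ(t)` for `wᵢ = hiᵢ(t)` — a trajectory starting strictly inside the box stays strictly inside on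
`[0,T]` (Müller 1927, Kamke 1932; Walter, *Differential and Integral Inequalities* §III.10; Coogan–Arcak 2015 for the mixed-monotone
embedding reading).

PROOF (first exit time).  If the conclusion failed, the violation set `V = {t ∈ [0,T] : ∃ i, zᵢ(t) ≤ loᵢ(t) ∨ hiᵢ(t) ≤ zᵢ(t)}` is
nonempty, closed (coordinates are continuous on `[0,T]`, being differentiable within it) and bounded below, so `t* = inf V ∈ V`,
`t* > 0` (strict at `0`), every coordinate lies in the CLOSED box at `t*` (left limits of strict inequalities on `[0,t*)`), and some
coordinate `i` touches a face, say `zᵢ(t*) = loᵢ(t*)`.  The face inequality at `w = z(t*)` and the disturbance bound give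
`(zᵢ − loᵢ)′(t*) ≥ fᵢ(z(t*)) − δ − lo′ᵢ(t*) > 0`, while the difference quotients of `zᵢ − loᵢ` from the left at `t*` are `≤ 0`
(positive before, zero at `t*`) and converge to that derivative along `𝓝[[0,t*)] t*` (`hasDerivWithinAt_iff_tendsto_slope`) —
contradiction; the upper face is symmetric.

WHAT THIS IS NOT: a 1927 ODE theorem, nothing about Navier–Stokes; the load-bearing stub of the line is `stub_enclosure`
(validated numerics).  No summit statement is proved here.
-/

noncomputable section

-- the summit and its single sub-problem share the name (CONVENTIONS §1), as in every Theorems file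
set_option linter.dupNamespace false

namespace Summit.NavierStokesRegularity.NavierStokesRegularity.Theorems.CompletionRelayChainRelayFrontStepMullerComparison

open Set Filter Topology

/-- **Müller's comparison theorem with disturbance** (strict form; derivatives within `Icc 0 T`; general `Fin n` system) —
VERBATIM the content of `MullerComparison` of line `coopembed_v1` (crux stmt-NavierStokesRegularity-24850): a trajectory of
`ż = f(z) + d`, `|dᵢ| ≤ δ`, starting strictly inside a `C¹` box whose faces satisfy the strict embedding inequalities stays strictly
inside on `[0,T]`.  (Müller 1927; Kamke 1932; Walter 1970 §III.10.) -/
theorem mullerComparison :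
    ∀ (n : ℕ) (T δ : ℝ) (f : (Fin n → ℝ) → Fin n → ℝ) (z z' lo lo' hi hi' : ℝ → Fin n → ℝ),
    0 ≤ T → 0 ≤ δ →
    (∀ t ∈ Icc (0 : ℝ) T, ∀ i : Fin n,
        HasDerivWithinAt (fun s => z s i) (z' t i) (Icc 0 T) t ∧
        HasDerivWithinAt (fun s => lo s i) (lo' t i) (Icc 0 T) t ∧
        HasDerivWithinAt (fun s => hi s i) (hi' t i) (Icc 0 T) t) →
    (∀ t ∈ Icc (0 : ℝ) T, ∀ i : Fin n, |z' t i - f (z t) i| ≤ δ) →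
    (∀ t ∈ Icc (0 : ℝ) T, ∀ (i : Fin n) (w : Fin n → ℝ), (∀ j, lo t j ≤ w j ∧ w j ≤ hi t j) →
        (w i = lo t i → lo' t i + δ < f w i) ∧ (w i = hi t i → f w i + δ < hi' t i)) →
    (∀ i : Fin n, lo 0 i < z 0 i ∧ z 0 i < hi 0 i) →
    ∀ t ∈ Icc (0 : ℝ) T, ∀ i : Fin n, lo t i < z t i ∧ z t i < hi t i := by
  intro n T δ f z z' lo lo' hi hi' _hT _hδ hder hdist hface h0 t₀ ht₀ i₀
  by_contra hcon
  -- ### the violation set and its infimum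
  set V : Set ℝ := {t | t ∈ Icc (0 : ℝ) T ∧ ∃ i : Fin n, z t i ≤ lo t i ∨ hi t i ≤ z t i} with hV
  have ht₀V : t₀ ∈ V := by
    refine ⟨ht₀, i₀, ?_⟩
    by_contra h
    push Not at h
    exact hcon ⟨not_le.1 fun h' => (not_le.2 h.1) h', not_le.1 fun h' => (not_le.2 h.2) h'⟩
  have hVne : V.Nonempty := ⟨t₀, ht₀V⟩
  have hVbdd : BddBelow V := ⟨0, fun t ht => ht.1.1⟩
  have hVsub : V ⊆ Icc (0 : ℝ) T := fun t ht => ht.1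
  -- continuity of the coordinates on `[0, T]`
  have hcz : ∀ i, ContinuousOn (fun s => z s i) (Icc 0 T) := fun i t ht => (hder t ht i).1.continuousWithinAt
  have hclo : ∀ i, ContinuousOn (fun s => lo s i) (Icc 0 T) := fun i t ht => (hder t ht i).2.1.continuousWithinAt
  have hchi : ∀ i, ContinuousOn (fun s => hi s i) (Icc 0 T) := fun i t ht => (hder t ht i).2.2.continuousWithinAt
  -- `V` is closed
  have hVc : IsClosed V := by
    have e : V = ⋃ i : Fin n,
        ({t | t ∈ Icc (0 : ℝ) T ∧ z t i ≤ lo t i} ∪ {t | t ∈ Icc (0 : ℝ) T ∧ hi t i ≤ z t i}) := by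
      ext t
      simp only [hV, mem_setOf_eq, mem_iUnion, mem_union]
      constructor
      · rintro ⟨ht, i, hi | hi⟩
        · exact ⟨i, Or.inl ⟨ht, hi⟩⟩
        · exact ⟨i, Or.inr ⟨ht, hi⟩⟩
      · rintro ⟨i, ⟨ht, hi⟩ | ⟨ht, hi⟩⟩
        · exact ⟨ht, i, Or.inl hi⟩
        · exact ⟨ht, i, Or.inr hi⟩
    rw [e]
    exact isClosed_iUnion_of_finite fun i =>
      (isClosed_Icc.isClosed_le (hcz i) (hclo i)).union (isClosed_Icc.isClosed_le (hchi i) (hcz i))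
  set τ : ℝ := sInf V with hτ
  have hτV : τ ∈ V := hVc.csInf_mem hVne hVbdd
  have hτI : τ ∈ Icc (0 : ℝ) T := hVsub hτV
  obtain ⟨-, i, hiV⟩ := hτV
  -- before `τ`: strictly inside
  have hbefore : ∀ s ∈ Icc (0 : ℝ) T, s < τ → ∀ j, lo s j < z s j ∧ z s j < hi s j := by
    intro s hs hsτ j
    by_contra h
    have hsV : s ∈ V := by
      refine ⟨hs, j, ?_⟩
      by_contra h'
      push Not at h'
      exact h ⟨not_le.1 fun h'' => (not_le.2 h'.1) h'', not_le.1 fun h'' => (not_le.2 h'.2) h''⟩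
    exact absurd (csInf_le hVbdd hsV) (not_le.2 hsτ)
  -- `τ > 0`
  have hτ0 : 0 < τ := by
    rcases eq_or_lt_of_le hτI.1 with h | h
    · exfalso
      rw [← h] at hiV
      rcases hiV with h1 | h1
      · exact absurd (h0 i).1 (not_lt.2 h1)
      · exact absurd (h0 i).2 (not_lt.2 h1)
    · exact h
  -- the left filter at `τ` inside `[0, τ)`
  have hIco : Ico (0 : ℝ) τ ⊆ Icc (0 : ℝ) T := fun s hs => ⟨hs.1, hs.2.le.trans hτI.2⟩
  haveI hbot : (𝓝[Ico (0 : ℝ) τ] τ).NeBot := by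
    refine mem_closure_iff_nhdsWithin_neBot.1 ?_
    rw [closure_Ico hτ0.ne]
    exact right_mem_Icc.2 hτ0.le
  -- every coordinate lies in the CLOSED box at `τ` (left limits)
  have hbox : ∀ j, lo τ j ≤ z τ j ∧ z τ j ≤ hi τ j := by
    intro j
    have tz : Tendsto (fun s => z s j) (𝓝[Ico (0 : ℝ) τ] τ) (𝓝 (z τ j)) :=
      ((hcz j) τ hτI).mono_left (nhdsWithin_mono _ hIco)
    have tlo : Tendsto (fun s => lo s j) (𝓝[Ico (0 : ℝ) τ] τ) (𝓝 (lo τ j)) :=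
      ((hclo j) τ hτI).mono_left (nhdsWithin_mono _ hIco)
    have thi : Tendsto (fun s => hi s j) (𝓝[Ico (0 : ℝ) τ] τ) (𝓝 (hi τ j)) :=
      ((hchi j) τ hτI).mono_left (nhdsWithin_mono _ hIco)
    have hev : ∀ᶠ s in 𝓝[Ico (0 : ℝ) τ] τ, lo s j ≤ z s j ∧ z s j ≤ hi s j :=
      eventually_nhdsWithin_of_forall fun s hs =>
        ⟨(hbefore s (hIco hs) hs.2 j).1.le, (hbefore s (hIco hs) hs.2 j).2.le⟩
    exact ⟨le_of_tendsto_of_tendsto tlo tz (hev.mono fun s hs => hs.1),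
      le_of_tendsto_of_tendsto tz thi (hev.mono fun s hs => hs.2)⟩
  -- the slope argument for a gap function `g`, positive on `[0, τ)`, zero at `τ`, with derivative `g'` within `[0, T]` at `τ`
  have key : ∀ (g : ℝ → ℝ) (g' : ℝ), HasDerivWithinAt g g' (Icc (0 : ℝ) T) τ → g τ = 0 →
      (∀ s ∈ Ico (0 : ℝ) τ, 0 < g s) → g' ≤ 0 := by
    intro g g' hg hgτ hgpos
    have hg' : HasDerivWithinAt g g' (Ico (0 : ℝ) τ) τ := hg.mono hIco
    have htend : Tendsto (slope g τ) (𝓝[Ico (0 : ℝ) τ] τ) (𝓝 g') := by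
      have h := hasDerivWithinAt_iff_tendsto_slope.1 hg'
      have hdiff : Ico (0 : ℝ) τ \ {τ} = Ico (0 : ℝ) τ := Set.sdiff_singleton_eq_self fun h => lt_irrefl τ h.2
      rwa [hdiff] at h
    refine le_of_tendsto htend (eventually_nhdsWithin_of_forall fun s hs => ?_)
    rw [slope_def_field, hgτ, sub_zero]
    exact (div_neg_of_pos_of_neg (hgpos s hs) (sub_neg.2 hs.2)).le
  -- ### the touched face
  rcases hiV with hlow | hhigh
  · -- lower face: `z τ i = lo τ i`
    have heq : z τ i = lo τ i := le_antisymm hlow (hbox i).1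
    have hf : lo' τ i + δ < f (z τ) i := (hface τ hτI i (z τ) hbox).1 heq
    have hd : f (z τ) i - δ ≤ z' τ i := by
      have h := (abs_le.1 (hdist τ hτI i)).1
      linarith
    have hle : z' τ i - lo' τ i ≤ 0 :=
      key (fun s => z s i - lo s i) (z' τ i - lo' τ i) ((hder τ hτI i).1.sub (hder τ hτI i).2.1)
        (sub_eq_zero.2 heq) (fun s hs => sub_pos.2 (hbefore s (hIco hs) hs.2 i).1)
    linarith
  · -- upper face: `z τ i = hi τ i`
    have heq : z τ i = hi τ i := le_antisymm (hbox i).2 hhigh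
    have hf : f (z τ) i + δ < hi' τ i := (hface τ hτI i (z τ) hbox).2 heq
    have hd : z' τ i ≤ f (z τ) i + δ := by
      have h := (abs_le.1 (hdist τ hτI i)).2
      linarith
    have hle : hi' τ i - z' τ i ≤ 0 :=
      key (fun s => hi s i - z s i) (hi' τ i - z' τ i) ((hder τ hτI i).2.2.sub (hder τ hτI i).1)
        (sub_eq_zero.2 heq.symm) (fun s hs => sub_pos.2 (hbefore s (hIco hs) hs.2 i).2)
    linarith

end Summit.NavierStokesRegularity.NavierStokesRegularity.Theorems.CompletionRelayChainRelayFrontStepMullerComparison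

end
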